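import Mathlib
import Summits.NavierStokesRegularity.NavierStokesRegularity.Theorems.SubOnsagerCeilingSideBranchChainDrive
import HarnessLib

/-!
# Route SubOnsagerCeiling — the POCKET METERS THE CUBE OF THE SIDE MODE of `α_SB` (pre-choke capture)
# (helper file for item stmt-NavierStokesRegularity-25507 `OrthantTailCeiling`; `--supports`; def-free)

Brick of the ENGINE for the escape construction behind the negative lemmas of the aside cruxes
`OrthantTailCeiling` / `ForwardTailCeiling` (p824789 / p824871; reduced to PER-SHELL RETENTION by
p825506).  The split estimate at shell `k` has two phases: AFTER the dead-end pocket `z_{k+1}` has reached a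
choke level `ζ` the side mode is slaved below one fifth of the chain receiver (`…SideBranchChoke`); BEFORE,
the side mode is undrained and one must bound how much energy it can hold when the pocket is still small.
This file gives that PRE-CHOKE bound, with no integrals:

* `sideBranch_side_cubed_le_pocket` — along a regular `ν`-viscous solution on `[0,s]` (`ν ≥ 0`), if on
  `[0,τ₀]` the feed is bounded, `Λ_k x_k² ≤ a` (`a > 0`), the side mode starts empty and stays `≥ 0`, and the
  pocket stays `≥ 0`, then **`Λ_k · s_k(τ₀)³ ≤ 3a · e^{ν_{k+1}τ₀} · z_{k+1}(τ₀)`**.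
  Reason: `ṡ_k ≤ a/5`, so looking back from `τ₀` the side mode was at least the ramp
  `S − (a/5)(τ₀−u)` (`S = s_k(τ₀)`) during the last `5S/a` units of time, and the pocket integrated its
  square: `z_{k+1}(τ₀) ≥ (Λ_k/5)·∫ramp² = Λ_k S³/(3a)` (up to the viscous factor).  Comparison functions
  `s_k(u) − (a/5)u` (non-increasing) and `z_{k+1}(u)e^{ν_{k+1}(u−u₀)} − (Λ_k/(3a))·ramp(u)³` (non-decreasing).

So at the moment the pocket first reaches a (small) choke level `ζ`, the side mode holds at most
`½(3aζe^{ν_{k+1}τ₀}/Λ_k)^{2/3}` — with `a = Λ_k X²` (`X` the running maximum of the chain mode) this is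
`½(3X²ζ e^{ν_{k+1}τ₀})^{2/3}`, small against `X²` when `ζ ≪ X`.

HONEST FRAMING: elementary real analysis of a Tao-type MODEL lattice ODE (route SubOnsagerCeiling, rung
TL-M2Break); a brick toward a construction that is NOT carried out here; nothing bears on Navier–Stokes
regularity; no crux is settled here. [cite: Tao2016AveragedNS, §4 (4.2)–(4.3)];
Katz–Pavlović couplings: [cite: BarbatoMorandinRomito2011, §2].
-/

noncomputable section

-- the sub-problem namespace `NavierStokesRegularity.NavierStokesRegularity` is the tree's layout (D-0017)
set_option linter.dupNamespace false

namespace Summit.NavierStokesRegularity.NavierStokesRegularity.Theorems.SubOnsagerCeiling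

open Set
open Literature.Analysis.FluidPDE.TaoCascade

section Solution

variable {ε₀ ν s : ℝ} {X : Fin 4 → ℤ → ℝ → ℝ}

/-- **The pocket meters the cube of the side mode.** Along a regular solution of the `ν`-viscous `α_SB`
lattice on `[0,s]` (`ν ≥ 0`), let `0 ≤ τ₀ ≤ s` and suppose on `[0, τ₀]`: `Λ_k x_k² ≤ a` with `a > 0`,
`s_k ≥ 0`, `z_{k+1} ≥ 0`, and `s_k(0) = 0`.  Then `Λ_k · s_k(τ₀)³ ≤ 3a · e^{ν_{k+1}τ₀} · z_{k+1}(τ₀)`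
(`Λ_n = (1+ε₀)^{5n/2}`, `ν_n = ν(1+ε₀)^{2n}`; `ṡ_k = Λ_k(x_k² − s_k z_{k+1})/5 − ν_k s_k`,
`ż_{k+1} = Λ_k s_k²/5 − ν_{k+1} z_{k+1}`). [this file] -/
theorem sideBranch_side_cubed_le_pocket (hε : 0 < ε₀) (hν : 0 ≤ ν)
    (hder : ∀ (i : Fin 4) (k : ℤ), ∀ t ∈ Icc (0 : ℝ) s, HasDerivWithinAt (X i k)
      (quadTerm ε₀ sideBranchTable X i k t - ν * (1 + ε₀) ^ ((2 : ℝ) * k) * X i k t)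
      (Icc (0 : ℝ) s) t)
    (k : ℤ) {τ₀ a : ℝ} (hτ₀ : 0 ≤ τ₀) (hτ₀s : τ₀ ≤ s) (ha : 0 < a)
    (hxa : ∀ u ∈ Icc (0 : ℝ) τ₀, (1 + ε₀) ^ ((5 : ℝ) * k / 2) * X 0 k u ^ 2 ≤ a)
    (hsk : ∀ u ∈ Icc (0 : ℝ) τ₀, 0 ≤ X 1 k u)
    (hz0 : ∀ u ∈ Icc (0 : ℝ) τ₀, 0 ≤ X 2 (k + 1) u)
    (hs0 : X 1 k 0 = 0) :
    (1 + ε₀) ^ ((5 : ℝ) * k / 2) * X 1 k τ₀ ^ 3 ≤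
      3 * a * Real.exp (ν * (1 + ε₀) ^ ((2 : ℝ) * ((k + 1 : ℤ) : ℝ)) * τ₀) * X 2 (k + 1) τ₀ := by
  have hb : (0 : ℝ) < 1 + ε₀ := by linarith
  set Λ : ℝ := (1 + ε₀) ^ ((5 : ℝ) * k / 2) with hΛ
  set c₀ : ℝ := ν * (1 + ε₀) ^ ((2 : ℝ) * k) with hc₀
  set c₁ : ℝ := ν * (1 + ε₀) ^ ((2 : ℝ) * ((k + 1 : ℤ) : ℝ)) with hc₁
  have hΛ0 : 0 < Λ := Real.rpow_pos_of_pos hb _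
  have hc₀0 : 0 ≤ c₀ := mul_nonneg hν (Real.rpow_nonneg hb.le _)
  have hc₁0 : 0 ≤ c₁ := mul_nonneg hν (Real.rpow_nonneg hb.le _)
  set S : ℝ := X 1 k τ₀ with hS
  have hsub0 : Icc (0 : ℝ) τ₀ ⊆ Icc (0 : ℝ) s := Icc_subset_Icc le_rfl hτ₀s
  have hτ₀mem : τ₀ ∈ Icc (0 : ℝ) τ₀ := ⟨hτ₀, le_rfl⟩
  have hS0 : 0 ≤ S := hsk τ₀ hτ₀mem
  -- Step 1: `ṡ_k ≤ a/5`, so `u ↦ s_k(u) − (a/5)u` is non-increasing on `[0, τ₀]`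
  have hsdot : ∀ u ∈ Icc (0 : ℝ) τ₀,
      quadTerm ε₀ sideBranchTable X 1 k u - c₀ * X 1 k u ≤ a / 5 := by
    intro u hu
    rw [sideBranch_quadTerm_one, ← hΛ]
    have h1 : 0 ≤ (1 / 5 : ℝ) * Λ * (X 1 k u * X 2 (k + 1) u) :=
      mul_nonneg (by positivity) (mul_nonneg (hsk u hu) (hz0 u hu))
    have h2 : 0 ≤ c₀ * X 1 k u := mul_nonneg hc₀0 (hsk u hu)
    have h3 := hxa u hu
    linarith
  have hramp : ∀ u ∈ Icc (0 : ℝ) τ₀, S - a / 5 * (τ₀ - u) ≤ X 1 k u := by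
    intro u hu
    -- on the window `[u, τ₀]`, `Ψ(w) = (a/5) w − s_k(w)` has derivative `≥ 0`
    have hsubu : Icc u τ₀ ⊆ Icc (0 : ℝ) s := Icc_subset_Icc hu.1 hτ₀s
    have hderΨ : ∀ w ∈ Icc u τ₀, HasDerivWithinAt (fun w => a / 5 * w - X 1 k w)
        (a / 5 * 1 - (quadTerm ε₀ sideBranchTable X 1 k w - c₀ * X 1 k w)) (Icc u τ₀) w :=
      fun w hw => ((hasDerivWithinAt_id w _).const_mul (a / 5)).sub ((hder 1 k w (hsubu hw)).mono hsubu)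
    have hpos : ∀ w ∈ Icc u τ₀,
        0 ≤ a / 5 * 1 - (quadTerm ε₀ sideBranchTable X 1 k w - c₀ * X 1 k w) := fun w hw => by
      have := hsdot w ⟨hu.1.trans hw.1, hw.2⟩; linarith
    have hmono := sideBranch_le_of_deriv_nonneg hderΨ hpos (right_mem_Icc.2 hu.2)
    rw [hS]; linarith
  -- Step 2: `S ≤ (a/5) τ₀`, so the ramp starts at `u₀ = τ₀ − 5S/a ∈ [0, τ₀]`
  have hSτ : S ≤ a / 5 * τ₀ := by
    have h := hramp 0 ⟨le_rfl, hτ₀⟩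
    rw [hs0] at h; linarith
  set u₀ : ℝ := τ₀ - 5 * S / a with hu₀
  have hu₀0 : 0 ≤ u₀ := by
    rw [hu₀, sub_nonneg, div_le_iff₀ ha]; linarith
  have hu₀τ : u₀ ≤ τ₀ := by
    rw [hu₀]; have : 0 ≤ 5 * S / a := by positivity
    linarith
  have hsub1 : Icc u₀ τ₀ ⊆ Icc (0 : ℝ) s := Icc_subset_Icc hu₀0 hτ₀s
  -- the ramp `φ(u) = S − (a/5)(τ₀ − u)` is `≥ 0` on `[u₀, τ₀]` and below `s_k`
  have hφ0 : ∀ u ∈ Icc u₀ τ₀, 0 ≤ S - a / 5 * (τ₀ - u) := by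
    intro u hu
    have h1 : τ₀ - u ≤ 5 * S / a := by rw [hu₀] at hu; linarith [hu.1]
    have h2 : a / 5 * (τ₀ - u) ≤ a / 5 * (5 * S / a) := mul_le_mul_of_nonneg_left h1 (by positivity)
    have h3 : a / 5 * (5 * S / a) = S := by field_simp
    linarith
  have hφs : ∀ u ∈ Icc u₀ τ₀, S - a / 5 * (τ₀ - u) ≤ X 1 k u :=
    fun u hu => hramp u ⟨hu₀0.trans hu.1, hu.2⟩
  -- Step 3: `W(u) = z_{k+1}(u) e^{c₁ (u − u₀)} − (Λ/(3a)) φ(u)³` is non-decreasing on `[u₀, τ₀]`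
  have hderW : ∀ u ∈ Icc u₀ τ₀, HasDerivWithinAt
      (fun u => X 2 (k + 1) u * Real.exp (c₁ * (u - u₀)) - Λ / (3 * a) * (S - a / 5 * (τ₀ - u)) ^ 3)
      ((quadTerm ε₀ sideBranchTable X 2 (k + 1) u - c₁ * X 2 (k + 1) u) * Real.exp (c₁ * (u - u₀)) +
        X 2 (k + 1) u * (Real.exp (c₁ * (u - u₀)) * (c₁ * 1)) -
        Λ / (3 * a) * (3 * (S - a / 5 * (τ₀ - u)) ^ 2 * (a / 5 * 1))) (Icc u₀ τ₀) u := by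
    intro u hu
    have h1 : HasDerivWithinAt (X 2 (k + 1))
        (quadTerm ε₀ sideBranchTable X 2 (k + 1) u - c₁ * X 2 (k + 1) u) (Icc u₀ τ₀) u :=
      (hder 2 (k + 1) u (hsub1 hu)).mono hsub1
    have h2 : HasDerivWithinAt (fun x => Real.exp (c₁ * (x - u₀)))
        (Real.exp (c₁ * (u - u₀)) * (c₁ * 1)) (Icc u₀ τ₀) u :=
      (((hasDerivAt_id' u).sub_const u₀).const_mul c₁).exp.hasDerivWithinAt
    have h3 : HasDerivWithinAt (fun x => S - a / 5 * (τ₀ - x)) (a / 5 * 1) (Icc u₀ τ₀) u :=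
      ((((hasDerivWithinAt_id u (Icc u₀ τ₀)).const_sub τ₀).const_mul (a / 5)).const_sub S).congr_deriv
        (by ring)
    have h4 : HasDerivWithinAt (fun x => (S - a / 5 * (τ₀ - x)) ^ 3)
        (3 * (S - a / 5 * (τ₀ - u)) ^ 2 * (a / 5 * 1)) (Icc u₀ τ₀) u :=
      (h3.pow 3).congr_deriv (by norm_num)
    exact (h1.mul h2).sub (h4.const_mul (Λ / (3 * a)))
  have hposW : ∀ u ∈ Icc u₀ τ₀, 0 ≤
      (quadTerm ε₀ sideBranchTable X 2 (k + 1) u - c₁ * X 2 (k + 1) u) * Real.exp (c₁ * (u - u₀)) +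
        X 2 (k + 1) u * (Real.exp (c₁ * (u - u₀)) * (c₁ * 1)) -
        Λ / (3 * a) * (3 * (S - a / 5 * (τ₀ - u)) ^ 2 * (a / 5 * 1)) := by
    intro u hu
    rw [sideBranch_quadTerm_two_succ, ← hΛ]
    have hE : 1 ≤ Real.exp (c₁ * (u - u₀)) := Real.one_le_exp (mul_nonneg hc₁0 (by linarith [hu.1]))
    have hφ := hφ0 u hu
    have hφs' := hφs u hu
    have hsq : (S - a / 5 * (τ₀ - u)) ^ 2 ≤ X 1 k u ^ 2 := pow_le_pow_left₀ hφ hφs' 2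
    have h1 : Λ / (3 * a) * (3 * (S - a / 5 * (τ₀ - u)) ^ 2 * (a / 5 * 1)) =
        (1 / 5 : ℝ) * Λ * (S - a / 5 * (τ₀ - u)) ^ 2 := by field_simp
    rw [h1]
    have h2 : (1 / 5 : ℝ) * Λ * X 1 k u ^ 2 ≤
        (1 / 5 : ℝ) * Λ * X 1 k u ^ 2 * Real.exp (c₁ * (u - u₀)) :=
      le_mul_of_one_le_right (by positivity) hE
    have h3 : (1 / 5 : ℝ) * Λ * (S - a / 5 * (τ₀ - u)) ^ 2 ≤ (1 / 5 : ℝ) * Λ * X 1 k u ^ 2 :=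
      mul_le_mul_of_nonneg_left hsq (by positivity)
    nlinarith [h2, h3]
  have hmonoW := sideBranch_le_of_deriv_nonneg hderW hposW (right_mem_Icc.2 hu₀τ)
  simp only [sub_self, mul_zero, Real.exp_zero, mul_one] at hmonoW
  -- evaluate: `φ(u₀) = 0`, `φ(τ₀) = S`, `z(u₀) ≥ 0`, `e^{c₁(τ₀−u₀)} ≤ e^{c₁ τ₀}`
  have hφu₀ : S - a / 5 * (τ₀ - u₀) = 0 := by rw [hu₀]; field_simp; ring
  rw [hφu₀] at hmonoW
  have hzu₀ : 0 ≤ X 2 (k + 1) u₀ := hz0 u₀ ⟨hu₀0, hu₀τ⟩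
  have hzτ₀ : 0 ≤ X 2 (k + 1) τ₀ := hz0 τ₀ hτ₀mem
  have hexp : Real.exp (c₁ * (τ₀ - u₀)) ≤ Real.exp (c₁ * τ₀) :=
    Real.exp_le_exp.2 (mul_le_mul_of_nonneg_left (by linarith) hc₁0)
  have h1 : X 2 (k + 1) τ₀ * Real.exp (c₁ * (τ₀ - u₀)) ≤ X 2 (k + 1) τ₀ * Real.exp (c₁ * τ₀) :=
    mul_le_mul_of_nonneg_left hexp hzτ₀
  have h2 : Λ / (3 * a) * S ^ 3 ≤ X 2 (k + 1) τ₀ * Real.exp (c₁ * τ₀) := by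
    simp only [sub_zero] at hmonoW
    nlinarith [hmonoW, hzu₀, h1]
  have h3 : Λ * S ^ 3 = 3 * a * (Λ / (3 * a) * S ^ 3) := by field_simp
  rw [h3]
  nlinarith [h2, ha]

end Solution

end Summit.NavierStokesRegularity.NavierStokesRegularity.Theorems.SubOnsagerCeiling

end
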